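import Summits.BirchSwinnertonDyer.BirchSwinnertonDyer.Theorems.ManinLocalTwoThreeKummerWitnessInvarianceDensity
import Summits.BirchSwinnertonDyer.BirchSwinnertonDyer.Theorems.ManinLocalTwoThreeKummerCubeRootCuspGrowth
import Summits.BirchSwinnertonDyer.Rank1Residual.ManinAdditive.UDCKummerWitnessLineB
import Literature.NumberTheory.EllipticCurves.ModularCurveManinConstantProofs
import HarnessLib

/-!
# (HOLB) PROVED: the B-witness `C₀·B_d·kummerMinBlock` extends holomorphically to `ℍ` and is bounded at every cusp
(route `ManinLocalTwoThree`, crux C3 `ManinPrimeToThreeAtNine` stmt-BirchSwinnertonDyer-22968; cell bsd-f2-manin, p2 gen 17;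
`--supports stmt-BirchSwinnertonDyer-22968`)

**`kummerMinimalWitnessExtensionB_holds : UDCKummerWitnessLine.KummerMinimalWitnessExtensionB`** — -an g38's typed B-line piece (HOLB)
(`UDCKummerWitnessLineB.lean`, p730675), BY NAME.  Given Γ₀(N)-forms `B_n, B_d` of weight `12m` with `B_d·(t_W∘φ) = B_n` on the good set
`{w ∉ Λ, y_W∘φ ≠ 0}` (`w = c·E_f`) and a constant `C₀`, the function
`F = C₀·B_n·W_{u,e}(w)` on `{σ(w) ≠ 0}`,  `F = C₀·B_d·Φ_min(w)` on `{Q(w) ≠ 0}`  (`Φ_min = −2A·e^{ew/3}/Q`, `Q, A` entire, `y_W∘φ = (c³/2)Q(w)/σ(w)³`)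
is holomorphic on `ℍ` (the two opens cover `ℍ`: **`Q ≠ 0` on `Λ`**, `ne_zero_of_mem_lattice_of_eq_periodic_mul_sigma_cube`, since `Q = E·σ³` with `E`
elliptic and `Q(0) = −2`), equals `C₀·B_d·kummerMinBlock` on the good set, and **`F ∣[12m] g` is BOUNDED at `i∞` for every `g ∈ SL(2, ℤ)`**
(`E_f(gτ) = C_g + V_g(τ)`, tree `exists_eichlerIntegral_smul_eq` / `exists_forall_eichlerIntegral_smul_notMem`; chart 1 if `c·C_g ∉ Λ`, chart 2 if the
cusp maps to `O`; `B_n ∣ g`, `B_d ∣ g` bounded by Mathlib `ModularFormClass.bdd_at_infty_slash`) — so the growth clause holds with `m' = 0`.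
NO pole-order bookkeeping, NO algebraicity (p2's AN2-d/e architecture on the minimal model).
HONEST FRAMING.  With (INVB) the B-line now has (INT), (HOLB), (INVB), (QXP) as theorems; (DICT), (RATB), (QEXNB) remain.  BSD is not proved by this;
Manin's conjecture is not proved; C2 and C3 remain OPEN.
[folklore]
-/

set_option autoImplicit false
-- lint-debt: the directory name repeats the summit name (sibling precedent `ManinLocalTwoThreeKummerWitnessInvariance.lean`)
set_option linter.dupNamespace false

noncomputable section

open scoped Topology PeriodPair MatrixGroups Manifold ModularForm
open Complex Filter CongruenceSubgroup
open UpperHalfPlane hiding I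
open Literature.NumberTheory.EllipticCurves Literature.NumberTheory.EllipticCurves.ModularForms
open Summit.BirchSwinnertonDyer.Rank1Residual.ManinAdditive.KummerCubeMonodromy
open Summit.BirchSwinnertonDyer.Rank1Residual.ManinAdditive.UDCKummerLine
open Summit.BirchSwinnertonDyer.Rank1Residual.ManinAdditive.UDCKummerWitnessLine
open Summit.BirchSwinnertonDyer.BirchSwinnertonDyer.Theorems.ManinLocalTwoThree.KummerCubeRootDictionary
open Summit.BirchSwinnertonDyer.BirchSwinnertonDyer.Theorems.ManinLocalTwoThree.KummerCubeSigmaLeaves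

namespace Summit.BirchSwinnertonDyer.BirchSwinnertonDyer.Theorems.ManinLocalTwoThree.WitnessInvariance

variable {W : WeierstrassCurve ℚ} {N : ℕ} [NeZero N]

/-! ### §1 An entire `Q = E·σ³` with `E` elliptic and `Q(0) ≠ 0` does not vanish on `Λ` -/

/-- `Q(λ) ≠ 0` for `λ ∈ Λ` whenever `Q` is entire, `Q = E·σ³` off `Λ` with `E` `Λ`-periodic off `Λ`, and `Q(0) ≠ 0`
(`Q(w + λ) = c_λ³e^{3η_λw}Q(w)` by the quasi-periodicity of `σ` and density of `ℂ ∖ Λ`). [folklore] -/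
theorem ne_zero_of_mem_lattice_of_eq_periodic_mul_sigma_cube (L : PeriodPair) {Q E : ℂ → ℂ}
    (hQ : Differentiable ℂ Q) (h0 : Q 0 ≠ 0)
    (heq : ∀ w, w ∉ L.lattice → Q w = E w * L.weierstrassSigma w ^ 3)
    (hE : ∀ w, w ∉ L.lattice → ∀ l ∈ L.lattice, E (w + l) = E w) {l : ℂ} (hl : l ∈ L.lattice) :
    Q l ≠ 0 := by
  obtain ⟨m₁, m₂, hm⟩ := PeriodPair.mem_lattice.mp hl
  obtain ⟨c, hc, -, hper⟩ := exists_weierstrassSigma_add_period L m₁ m₂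
  rw [hm] at hper
  have h1 : Continuous fun w => Q (w + l) := hQ.continuous.comp (continuous_id.add continuous_const)
  have h2 : Continuous fun w => c ^ 3 * cexp ((m₁ * L.η₁ + m₂ * L.η₂) * w) ^ 3 * Q w :=
    (continuous_const.mul ((continuous_const.mul continuous_id).cexp.pow 3)).mul hQ.continuous
  have hdense : Dense ((L.lattice : Set ℂ)ᶜ) := L.countable_lattice.dense_compl ℂ
  have heqOn : Set.EqOn (fun w => Q (w + l)) (fun w => c ^ 3 * cexp ((m₁ * L.η₁ + m₂ * L.η₂) * w) ^ 3 * Q w)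
      ((L.lattice : Set ℂ)ᶜ) := by
    intro w hw
    have hw' : w ∉ L.lattice := hw
    have hwl : w + l ∉ L.lattice := fun h => hw' (by simpa using L.lattice.sub_mem h hl)
    simp only
    rw [heq _ hwl, heq _ hw', hper w, hE w hw' l hl]
    ring
  have hfun := Continuous.ext_on hdense h1 h2 heqOn
  have h0' := congrFun hfun 0
  simp only [zero_add, mul_zero, Complex.exp_zero, one_pow, mul_one] at h0'
  rw [h0']
  exact mul_ne_zero (pow_ne_zero 3 hc) h0

/-! ### §2 The minimal package, with `Q ≠ 0` on `Λ` and the chart-2 function -/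

/-- **The minimal package (extended).**  Entire `Q`, non-vanishing on `Λ`, and a chart-2 function `Φ`, differentiable wherever `Q ≠ 0`, with
`y_W∘φ = (c³/2)Q(w)/σ(w)³` off `φ⁻¹(O)` and `kummerMinBlock = Φ(w)` where moreover `Q(w) ≠ 0`. [folklore] -/
theorem exists_minimal_package' (D : ModularParametrizationData W N) (hc0 : D.c ≠ 0) (u e : ℂ) :
    ∃ Q Φ : ℂ → ℂ, Differentiable ℂ Q ∧ (∀ l ∈ D.L.lattice, Q l ≠ 0) ∧ (∀ w, Q w ≠ 0 → DifferentiableAt ℂ Φ w) ∧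
      (∀ τ : ℍ, (D.c : ℂ) * eichlerIntegral D.f τ ∉ D.L.lattice →
        minimalY D τ = (D.c : ℂ) ^ 3 / 2 * Q ((D.c : ℂ) * eichlerIntegral D.f τ) /
          D.L.weierstrassSigma ((D.c : ℂ) * eichlerIntegral D.f τ) ^ 3) ∧
      (∀ τ : ℍ, (D.c : ℂ) * eichlerIntegral D.f τ ∉ D.L.lattice → Q ((D.c : ℂ) * eichlerIntegral D.f τ) ≠ 0 →
        kummerMinBlock D u e τ = Φ ((D.c : ℂ) * eichlerIntegral D.f τ)) := by
  obtain ⟨P₂, P₃, hP₂, hP₃, -, hP₃0, hP₂eq, hP₃eq⟩ := exists_entire_weierstrassP_sigma_values D.L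
  have hσ : Differentiable ℂ D.L.weierstrassSigma := D.L.differentiable_weierstrassSigma_holds
  have hc : (D.c : ℂ) ≠ 0 := Int.cast_ne_zero.mpr hc0
  have hσne : ∀ w, w ∉ D.L.lattice → D.L.weierstrassSigma w ≠ 0 := fun w hw h =>
    hw ((D.L.weierstrassSigma_eq_zero_iff_holds w).mp h)
  set Q : ℂ → ℂ := fun w => P₃ w - (W.a₁ : ℂ) * P₂ w * D.L.weierstrassSigma w +
      ((W.a₁ : ℂ) * (W.b₂ : ℂ) / 12 - (W.a₃ : ℂ)) * D.L.weierstrassSigma w ^ 3 with hQdef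
  set A : ℂ → ℂ := fun w => (P₂ w - (W.b₂ : ℂ) / 12 * D.L.weierstrassSigma w ^ 2) * D.L.weierstrassSigma (w - u) with hAdef
  have hQd : Differentiable ℂ Q :=
    ((hP₃.sub ((differentiable_const _).mul hP₂ |>.mul hσ)).add ((differentiable_const _).mul (hσ.pow 3)))
  have hAd : Differentiable ℂ A :=
    (hP₂.sub ((differentiable_const _).mul (hσ.pow 2))).mul (hσ.comp (differentiable_id.sub_const u))
  have hQ0 : Q 0 = -2 := by simp [hQdef, hP₃0]
  have hQE : ∀ w, w ∉ D.L.lattice →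
      Q w = (℘'[D.L] w - (W.a₁ : ℂ) * ℘[D.L] w + ((W.a₁ : ℂ) * (W.b₂ : ℂ) / 12 - (W.a₃ : ℂ))) * D.L.weierstrassSigma w ^ 3 := by
    intro w hw
    simp only [hQdef]
    rw [hP₃eq w hw, hP₂eq w hw]
    ring
  have hQΛ : ∀ l ∈ D.L.lattice, Q l ≠ 0 := by
    intro l hl
    refine ne_zero_of_mem_lattice_of_eq_periodic_mul_sigma_cube D.L hQd (by rw [hQ0]; norm_num) hQE ?_ hl
    intro w hw l' hl'
    rw [show w + l' = w + ((⟨l', hl'⟩ : D.L.lattice) : ℂ) from rfl, PeriodPair.weierstrassP_add_coe,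
      PeriodPair.derivWeierstrassP_add_coe]
  refine ⟨Q, fun w => -2 * A w * cexp (e * w / 3) / Q w, hQd, hQΛ, ?_, ?_, ?_⟩
  · intro w hw
    exact ((((differentiableAt_const _).mul (hAd w)).mul
      (((differentiableAt_const _).mul differentiableAt_id).div_const _).cexp).div (hQd w) hw)
  · intro τ hw
    set w : ℂ := (D.c : ℂ) * eichlerIntegral D.f τ with hw_def
    have hσw := hσne w hw
    have h℘ : ℘[D.L] w = P₂ w / D.L.weierstrassSigma w ^ 2 := by
      rw [hP₂eq w hw]; field_simp
    have h℘' : ℘'[D.L] w = P₃ w / D.L.weierstrassSigma w ^ 3 := by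
      rw [hP₃eq w hw]; field_simp
    rw [minimalY, shortX, shortY, ← hw_def, h℘, h℘']
    simp only [hQdef]
    field_simp
    ring
  · intro τ hw hQw
    set w : ℂ := (D.c : ℂ) * eichlerIntegral D.f τ with hw_def
    have hσw := hσne w hw
    have h℘ : ℘[D.L] w = P₂ w / D.L.weierstrassSigma w ^ 2 := by
      rw [hP₂eq w hw]; field_simp
    have h℘' : ℘'[D.L] w = P₃ w / D.L.weierstrassSigma w ^ 3 := by
      rw [hP₃eq w hw]; field_simp
    have hY : minimalY D τ = (D.c : ℂ) ^ 3 / 2 * Q w / D.L.weierstrassSigma w ^ 3 := by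
      rw [minimalY, shortX, shortY, ← hw_def, h℘, h℘']
      simp only [hQdef]
      field_simp
      ring
    have hQw' : Q w ≠ 0 := hQw
    rw [kummerMinBlock, minimalParam, sigmaCubeRoot, hY, shortX, ← hw_def, h℘]
    simp only [hQdef, hAdef] at hQw' ⊢
    field_simp

/-! ### §3 (HOLB) by name -/

/-- **(HOLB) `KummerMinimalWitnessExtensionB` holds.**  See the file header. [folklore] -/
theorem kummerMinimalWitnessExtensionB_holds : KummerMinimalWitnessExtensionB := by
  intro W _ _ N _ D u hu m₁ m₂ _h3u m Bn Bd hpres C₀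
  classical
  have hc0 : D.c ≠ 0 := D.maninConstant_ne_zero_holds
  have hf : D.f ≠ 0 := newform_ne_zero D
  have hc : (D.c : ℂ) ≠ 0 := Int.cast_ne_zero.mpr hc0
  set e : ℂ := m₁ * D.L.η₁ + m₂ * D.L.η₂ with he
  obtain ⟨Q, Φ, hQd, hQΛ, hΦd, hY, hblock⟩ := exists_minimal_package' D hc0 u e
  have hσd : Differentiable ℂ D.L.weierstrassSigma := D.L.differentiable_weierstrassSigma_holds
  have hσne : ∀ w, w ∉ D.L.lattice → D.L.weierstrassSigma w ≠ 0 := fun w hw h =>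
    hw ((D.L.weierstrassSigma_eq_zero_iff_holds w).mp h)
  have hX : Differentiable ℂ (fun w => cexp (e * w / 3) * D.L.weierstrassSigma (w - u)) :=
    (((differentiable_const _).mul differentiable_id).div_const _).cexp.mul (hσd.comp (differentiable_id.sub_const u))
  -- good ⟸ `w ∉ Λ ∧ Q(w) ≠ 0`
  have hgood : ∀ τ : ℍ, (D.c : ℂ) * eichlerIntegral D.f τ ∉ D.L.lattice → Q ((D.c : ℂ) * eichlerIntegral D.f τ) ≠ 0 →
      minimalY D τ ≠ 0 := by
    intro τ hw hQ
    rw [hY τ hw]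
    exact div_ne_zero (mul_ne_zero (div_ne_zero (pow_ne_zero 3 hc) two_ne_zero) hQ) (pow_ne_zero 3 (hσne _ hw))
  -- the chart-1 value equals `C₀·B_d·block` on the good set, and the chart-2 value where `Q ≠ 0`
  have hval1 : ∀ τ : ℍ, (D.c : ℂ) * eichlerIntegral D.f τ ∉ D.L.lattice → minimalY D τ ≠ 0 →
      C₀ * Bn τ * sigmaCubeRoot D.L u e ((D.c : ℂ) * eichlerIntegral D.f τ) = C₀ * Bd τ * kummerMinBlock D u e τ := by
    intro τ hw hYne
    rw [← hpres τ hw hYne, kummerMinBlock]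
    ring
  have hval2 : ∀ τ : ℍ, (D.c : ℂ) * eichlerIntegral D.f τ ∉ D.L.lattice → Q ((D.c : ℂ) * eichlerIntegral D.f τ) ≠ 0 →
      C₀ * Bn τ * sigmaCubeRoot D.L u e ((D.c : ℂ) * eichlerIntegral D.f τ) = C₀ * Bd τ * Φ ((D.c : ℂ) * eichlerIntegral D.f τ) := by
    intro τ hw hQ
    rw [hval1 τ hw (hgood τ hw hQ), hblock τ hw hQ]
  refine ⟨fun τ => if (D.c : ℂ) * eichlerIntegral D.f τ ∈ D.L.lattice then C₀ * Bd τ * Φ ((D.c : ℂ) * eichlerIntegral D.f τ)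
      else C₀ * Bn τ * sigmaCubeRoot D.L u e ((D.c : ℂ) * eichlerIntegral D.f τ), ?_, ?_, ?_⟩
  · -- holomorphy, in the complex coordinate
    intro τ₀
    rw [UpperHalfPlane.mdifferentiableAt_iff]
    have hEd : DifferentiableAt ℂ (fun z : ℂ => (D.c : ℂ) * eichlerIntegral D.f (ofComplex z)) (τ₀ : ℂ) :=
      (differentiableAt_const _).mul (hasDerivAt_eichlerIntegral D.f τ₀.im_pos).differentiableAt
    have hBnd : DifferentiableAt ℂ (⇑Bn ∘ ofComplex) (τ₀ : ℂ) := UpperHalfPlane.mdifferentiableAt_iff.mp (ModularFormClass.holo Bn τ₀)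
    have hBdd : DifferentiableAt ℂ (⇑Bd ∘ ofComplex) (τ₀ : ℂ) := UpperHalfPlane.mdifferentiableAt_iff.mp (ModularFormClass.holo Bd τ₀)
    have hw0 : (D.c : ℂ) * eichlerIntegral D.f (ofComplex (τ₀ : ℂ)) = (D.c : ℂ) * eichlerIntegral D.f τ₀ := by
      rw [ofComplex_apply]
    by_cases hΛ0 : (D.c : ℂ) * eichlerIntegral D.f τ₀ ∈ D.L.lattice
    · -- chart 2
      have hQ0 : Q ((D.c : ℂ) * eichlerIntegral D.f (ofComplex (τ₀ : ℂ))) ≠ 0 := by rw [hw0]; exact hQΛ _ hΛ0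
      have hev1 : ∀ᶠ z in 𝓝 (τ₀ : ℂ), Q ((D.c : ℂ) * eichlerIntegral D.f (ofComplex z)) ≠ 0 :=
        ((hQd.continuous.continuousAt).comp_of_eq hEd.continuousAt rfl).eventually_ne hQ0
      have hFeq : ((fun τ => if (D.c : ℂ) * eichlerIntegral D.f τ ∈ D.L.lattice then C₀ * Bd τ * Φ ((D.c : ℂ) * eichlerIntegral D.f τ)
            else C₀ * Bn τ * sigmaCubeRoot D.L u e ((D.c : ℂ) * eichlerIntegral D.f τ)) ∘ ofComplex) =ᶠ[𝓝 (τ₀ : ℂ)]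
          fun z => C₀ * (⇑Bd ∘ ofComplex) z * Φ ((D.c : ℂ) * eichlerIntegral D.f (ofComplex z)) := by
        filter_upwards [hev1] with z h1
        simp only [Function.comp_apply]
        by_cases hz : (D.c : ℂ) * eichlerIntegral D.f (ofComplex z) ∈ D.L.lattice
        · rw [if_pos hz]
        · rw [if_neg hz, hval2 (ofComplex z) hz h1]
      have hg : DifferentiableAt ℂ (fun z => C₀ * (⇑Bd ∘ ofComplex) z * Φ ((D.c : ℂ) * eichlerIntegral D.f (ofComplex z))) (τ₀ : ℂ) :=
        ((differentiableAt_const _).mul hBdd).mul ((hΦd _ hQ0).comp (τ₀ : ℂ) hEd)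
      exact hFeq.differentiableAt_iff.mpr hg
    · -- chart 1
      have hopen : IsOpen ((D.L.lattice : Set ℂ)ᶜ) := D.L.isClosed_lattice.isOpen_compl
      have hmem : (D.c : ℂ) * eichlerIntegral D.f (ofComplex (τ₀ : ℂ)) ∈ ((D.L.lattice : Set ℂ)ᶜ) := by
        rw [hw0]; exact hΛ0
      have hev : ∀ᶠ z in 𝓝 (τ₀ : ℂ), (D.c : ℂ) * eichlerIntegral D.f (ofComplex z) ∉ D.L.lattice :=
        hEd.continuousAt.preimage_mem_nhds (hopen.mem_nhds hmem)
      have hFeq : ((fun τ => if (D.c : ℂ) * eichlerIntegral D.f τ ∈ D.L.lattice then C₀ * Bd τ * Φ ((D.c : ℂ) * eichlerIntegral D.f τ)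
            else C₀ * Bn τ * sigmaCubeRoot D.L u e ((D.c : ℂ) * eichlerIntegral D.f τ)) ∘ ofComplex) =ᶠ[𝓝 (τ₀ : ℂ)]
          fun z => C₀ * (⇑Bn ∘ ofComplex) z * (cexp (e * ((D.c : ℂ) * eichlerIntegral D.f (ofComplex z)) / 3) *
            D.L.weierstrassSigma ((D.c : ℂ) * eichlerIntegral D.f (ofComplex z) - u) /
            D.L.weierstrassSigma ((D.c : ℂ) * eichlerIntegral D.f (ofComplex z))) := by
        filter_upwards [hev] with z hz
        simp only [Function.comp_apply]
        rw [if_neg hz, sigmaCubeRoot]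
      have hσ0 : D.L.weierstrassSigma ((D.c : ℂ) * eichlerIntegral D.f (ofComplex (τ₀ : ℂ))) ≠ 0 := by
        rw [hw0]; exact hσne _ hΛ0
      have hXz : DifferentiableAt ℂ (fun z : ℂ => cexp (e * ((D.c : ℂ) * eichlerIntegral D.f (ofComplex z)) / 3) *
          D.L.weierstrassSigma ((D.c : ℂ) * eichlerIntegral D.f (ofComplex z) - u)) (τ₀ : ℂ) :=
        (hX _).comp (τ₀ : ℂ) hEd
      have hσz : DifferentiableAt ℂ (fun z : ℂ => D.L.weierstrassSigma ((D.c : ℂ) * eichlerIntegral D.f (ofComplex z))) (τ₀ : ℂ) :=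
        (hσd _).comp (τ₀ : ℂ) hEd
      have hg : DifferentiableAt ℂ (fun z => C₀ * (⇑Bn ∘ ofComplex) z *
          (cexp (e * ((D.c : ℂ) * eichlerIntegral D.f (ofComplex z)) / 3) *
            D.L.weierstrassSigma ((D.c : ℂ) * eichlerIntegral D.f (ofComplex z) - u) /
            D.L.weierstrassSigma ((D.c : ℂ) * eichlerIntegral D.f (ofComplex z)))) (τ₀ : ℂ) :=
        ((differentiableAt_const _).mul hBnd).mul (hXz.div hσz hσ0)
      exact hFeq.differentiableAt_iff.mpr hg
  · -- the formula on the good set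
    intro τ hw hYne
    simp only [if_neg hw]
    exact hval1 τ hw hYne
  · -- boundedness at every cusp
    intro g
    obtain ⟨Cg, hCg⟩ := exists_eichlerIntegral_smul_eq D.f g
    have hφ := isCuspFunction_slash (k := 2) D.f g
    obtain ⟨T₁, hT₁⟩ :=
      exists_forall_eichlerIntegral_smul_notMem D.f hf (D.L.mulLeft ((D.c : ℂ)⁻¹) (inv_ne_zero hc)) g
    have hT₁' : ∀ τ : ℍ, T₁ ≤ τ.im → (D.c : ℂ) * eichlerIntegral D.f (g • τ) ∉ D.L.lattice := by
      intro τ hτ h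
      apply hT₁ τ hτ
      rw [PeriodPair.mem_mulLeft_lattice, inv_inv]
      exact h
    obtain ⟨MBn, ABn, hMBn⟩ := UpperHalfPlane.isBoundedAtImInfty_iff.mp (ModularFormClass.bdd_at_infty_slash Bn g)
    obtain ⟨MBd, ABd, hMBd⟩ := UpperHalfPlane.isBoundedAtImInfty_iff.mp (ModularFormClass.bdd_at_infty_slash Bd g)
    have hcpos : 0 < ‖(D.c : ℂ)‖ + 1 := by positivity
    have happroach : ∀ δ : ℝ, 0 < δ → ∃ M : ℝ, ∀ τ : ℍ, M ≤ τ.im →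
        dist ((D.c : ℂ) * eichlerIntegral D.f (g • τ)) ((D.c : ℂ) * Cg) < δ := by
      intro δ hδ
      obtain ⟨M, hM⟩ := hφ.exists_forall_norm_verticalIntegral_le (ε := δ / (‖(D.c : ℂ)‖ + 1)) (by positivity)
      refine ⟨M, fun τ hτ => ?_⟩
      rw [dist_eq_norm, hCg τ, mul_add, add_sub_cancel_left, norm_mul]
      calc ‖(D.c : ℂ)‖ * ‖verticalIntegral (⇑D.f ∣[(2 : ℤ)] g) τ‖
          ≤ ‖(D.c : ℂ)‖ * (δ / (‖(D.c : ℂ)‖ + 1)) := mul_le_mul_of_nonneg_left (hM τ hτ) (norm_nonneg _)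
        _ < δ := by
            rw [mul_div_assoc', div_lt_iff₀ hcpos]
            nlinarith [norm_nonneg (D.c : ℂ)]
    by_cases hΛ : (D.c : ℂ) * Cg ∈ D.L.lattice
    · -- the cusp maps to `O`: chart 2
      have hQ0 : Q ((D.c : ℂ) * Cg) ≠ 0 := hQΛ _ hΛ
      obtain ⟨δ₁, hδ₁, hΦball⟩ := Metric.continuousAt_iff.mp (hΦd _ hQ0).continuousAt 1 one_pos
      obtain ⟨δ₂, hδ₂, hQball⟩ := Metric.eventually_nhds_iff.mp ((hQd _).continuousAt.eventually_ne hQ0)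
      obtain ⟨M₃, hM₃⟩ := happroach (min δ₁ δ₂) (lt_min hδ₁ hδ₂)
      refine ⟨‖C₀‖ * MBd * (‖Φ ((D.c : ℂ) * Cg)‖ + 1), max T₁ (max ABd M₃), 0, fun τ hτ => ?_⟩
      have h1 : T₁ ≤ τ.im := (le_max_left _ _).trans hτ
      have hA : ABd ≤ τ.im := (le_max_left _ _).trans ((le_max_right _ _).trans hτ)
      have h3 : M₃ ≤ τ.im := (le_max_right _ _).trans ((le_max_right _ _).trans hτ)
      have hdist := hM₃ τ h3
      have hnotin := hT₁' τ h1
      have hQw : Q ((D.c : ℂ) * eichlerIntegral D.f (g • τ)) ≠ 0 := hQball (lt_of_lt_of_le hdist (min_le_right _ _))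
      have hFval : (if (D.c : ℂ) * eichlerIntegral D.f (g • τ) ∈ D.L.lattice then
            C₀ * Bd (g • τ) * Φ ((D.c : ℂ) * eichlerIntegral D.f (g • τ))
          else C₀ * Bn (g • τ) * sigmaCubeRoot D.L u e ((D.c : ℂ) * eichlerIntegral D.f (g • τ))) =
          C₀ * Bd (g • τ) * Φ ((D.c : ℂ) * eichlerIntegral D.f (g • τ)) := by
        rw [if_neg hnotin, hval2 _ hnotin hQw]
      have hΦbd : ‖Φ ((D.c : ℂ) * eichlerIntegral D.f (g • τ))‖ ≤ ‖Φ ((D.c : ℂ) * Cg)‖ + 1 :=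
        norm_le_norm_add_one_of_dist_lt (hΦball (lt_of_lt_of_le hdist (min_le_left _ _)))
      have hBg := hMBd τ hA
      rw [ModularForm.SL_slash_apply] at hBg
      rw [Real.exp_eq_one_iff _ |>.mpr (by ring), mul_one, ModularForm.SL_slash_apply, hFval,
        show C₀ * Bd (g • τ) * Φ ((D.c : ℂ) * eichlerIntegral D.f (g • τ)) * denom (↑g) τ ^ (-(12 * (m : ℤ))) =
          C₀ * ((Bd (g • τ) * denom (↑g) τ ^ (-(12 * (m : ℤ)))) * Φ ((D.c : ℂ) * eichlerIntegral D.f (g • τ))) by ring,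
        norm_mul, norm_mul]
      have hC : 0 ≤ ‖C₀‖ := norm_nonneg _
      have hMBd0 : 0 ≤ MBd := (norm_nonneg _).trans hBg
      calc ‖C₀‖ * (‖Bd (g • τ) * denom (↑g) τ ^ (-(12 * (m : ℤ)))‖ * ‖Φ ((D.c : ℂ) * eichlerIntegral D.f (g • τ))‖)
          ≤ ‖C₀‖ * (MBd * (‖Φ ((D.c : ℂ) * Cg)‖ + 1)) :=
            mul_le_mul_of_nonneg_left (mul_le_mul hBg hΦbd (norm_nonneg _) hMBd0) hC
        _ = ‖C₀‖ * MBd * (‖Φ ((D.c : ℂ) * Cg)‖ + 1) := by ring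
    · -- the cusp maps to a point `≠ O`: chart 1
      have hσ0 : D.L.weierstrassSigma ((D.c : ℂ) * Cg) ≠ 0 := hσne _ hΛ
      have hVc : ContinuousAt (fun w => cexp (e * w / 3) * D.L.weierstrassSigma (w - u) / D.L.weierstrassSigma w) ((D.c : ℂ) * Cg) :=
        ((hX _).div (hσd _) hσ0).continuousAt
      obtain ⟨δ₁, hδ₁, hVball⟩ := Metric.continuousAt_iff.mp hVc 1 one_pos
      obtain ⟨M₃, hM₃⟩ := happroach δ₁ hδ₁
      refine ⟨‖C₀‖ * MBn * (‖cexp (e * ((D.c : ℂ) * Cg) / 3) * D.L.weierstrassSigma ((D.c : ℂ) * Cg - u) /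
          D.L.weierstrassSigma ((D.c : ℂ) * Cg)‖ + 1), max T₁ (max ABn M₃), 0, fun τ hτ => ?_⟩
      have h1 : T₁ ≤ τ.im := (le_max_left _ _).trans hτ
      have hA : ABn ≤ τ.im := (le_max_left _ _).trans ((le_max_right _ _).trans hτ)
      have h3 : M₃ ≤ τ.im := (le_max_right _ _).trans ((le_max_right _ _).trans hτ)
      have hdist := hM₃ τ h3
      have hnotin := hT₁' τ h1
      have hFval : (if (D.c : ℂ) * eichlerIntegral D.f (g • τ) ∈ D.L.lattice then
            C₀ * Bd (g • τ) * Φ ((D.c : ℂ) * eichlerIntegral D.f (g • τ))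
          else C₀ * Bn (g • τ) * sigmaCubeRoot D.L u e ((D.c : ℂ) * eichlerIntegral D.f (g • τ))) =
          C₀ * Bn (g • τ) * (cexp (e * ((D.c : ℂ) * eichlerIntegral D.f (g • τ)) / 3) *
            D.L.weierstrassSigma ((D.c : ℂ) * eichlerIntegral D.f (g • τ) - u) /
            D.L.weierstrassSigma ((D.c : ℂ) * eichlerIntegral D.f (g • τ))) := by
        rw [if_neg hnotin, sigmaCubeRoot]
      have hVbd : ‖cexp (e * ((D.c : ℂ) * eichlerIntegral D.f (g • τ)) / 3) *
            D.L.weierstrassSigma ((D.c : ℂ) * eichlerIntegral D.f (g • τ) - u) /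
            D.L.weierstrassSigma ((D.c : ℂ) * eichlerIntegral D.f (g • τ))‖ ≤
          ‖cexp (e * ((D.c : ℂ) * Cg) / 3) * D.L.weierstrassSigma ((D.c : ℂ) * Cg - u) / D.L.weierstrassSigma ((D.c : ℂ) * Cg)‖ + 1 :=
        norm_le_norm_add_one_of_dist_lt (hVball hdist)
      have hBg := hMBn τ hA
      rw [ModularForm.SL_slash_apply] at hBg
      rw [Real.exp_eq_one_iff _ |>.mpr (by ring), mul_one, ModularForm.SL_slash_apply, hFval,
        show C₀ * Bn (g • τ) * (cexp (e * ((D.c : ℂ) * eichlerIntegral D.f (g • τ)) / 3) *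
            D.L.weierstrassSigma ((D.c : ℂ) * eichlerIntegral D.f (g • τ) - u) /
            D.L.weierstrassSigma ((D.c : ℂ) * eichlerIntegral D.f (g • τ))) * denom (↑g) τ ^ (-(12 * (m : ℤ))) =
          C₀ * ((Bn (g • τ) * denom (↑g) τ ^ (-(12 * (m : ℤ)))) *
            (cexp (e * ((D.c : ℂ) * eichlerIntegral D.f (g • τ)) / 3) *
              D.L.weierstrassSigma ((D.c : ℂ) * eichlerIntegral D.f (g • τ) - u) /
              D.L.weierstrassSigma ((D.c : ℂ) * eichlerIntegral D.f (g • τ)))) by ring,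
        norm_mul, norm_mul]
      have hC : 0 ≤ ‖C₀‖ := norm_nonneg _
      have hMBn0 : 0 ≤ MBn := (norm_nonneg _).trans hBg
      calc ‖C₀‖ * (‖Bn (g • τ) * denom (↑g) τ ^ (-(12 * (m : ℤ)))‖ *
            ‖cexp (e * ((D.c : ℂ) * eichlerIntegral D.f (g • τ)) / 3) *
              D.L.weierstrassSigma ((D.c : ℂ) * eichlerIntegral D.f (g • τ) - u) /
              D.L.weierstrassSigma ((D.c : ℂ) * eichlerIntegral D.f (g • τ))‖)
          ≤ ‖C₀‖ * (MBn * (‖cexp (e * ((D.c : ℂ) * Cg) / 3) * D.L.weierstrassSigma ((D.c : ℂ) * Cg - u) /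
              D.L.weierstrassSigma ((D.c : ℂ) * Cg)‖ + 1)) :=
            mul_le_mul_of_nonneg_left (mul_le_mul hBg hVbd (norm_nonneg _) hMBn0) hC
        _ = _ := by ring

end Summit.BirchSwinnertonDyer.BirchSwinnertonDyer.Theorems.ManinLocalTwoThree.WitnessInvariance

end
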